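import Summits.BirchSwinnertonDyer.Rank1Residual.O5.HeegnerLogTransportThreeBSDp
import Summits.BirchSwinnertonDyer.Rank1Residual.O5.HeegnerLogTransportThreeHeegnerIndexRow48841a1
import Literature.NumberTheory.EllipticCurves.ManinConstantSemistablePrimewise
import Literature.NumberTheory.EllipticCurves.CuspFormLFunctionLevelConductorProofs
import Literature.NumberTheory.EllipticCurves.AnalyticRankModularityProofs
import Summits.BirchSwinnertonDyer.Rank1Residual.O5.HeegnerHypothesisOfDiscr
import HarnessLib
import HarnessLib.Audit.Tags

/-!
# Heegner-log transport at `p = 3` (KL3), part 32d — the two SUPERSINGULAR-companion rows of record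
# `439569bw1 ~ 48841a1` and `439569e1 ~ 48841a1` (`K = ℚ(√−263)`, `d_K = −263`) in the cell's closing
# currency: `BSDp 439569bw1 3`, `BSDp 439569e1 3`
# (o5-r2 GEN 33; STAGED: imports part 32 = `O5.HeegnerLogTransportThreeBSDp` (by-sha ask A-O5-G32-1) and
# the 27d ROW `O5.HeegnerLogTransportThreeHeegnerIndexRow48841a1` (typer-staged after p368050); §1 was
# farm-checked standalone against BUILT modules in `gen33/scratch/TwistModelsKL3Five_scratch.lean` (rc 0,
# 0 warnings, axioms standard); §2 is the mechanical mirror of the checked `o5_bsdp_row240930b1`, through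
# the Heegner-index END instead of the two-sided END.)

GEN 35 (this file SUPERSEDES the GEN 34 bytes of the same name; o5-r2 GEN 35, memo `HOME/b2b-bsdres-o5-r2/gen35/O5-GEN35.md`):
(1) MAZUR FOR THE COMPANION. The companion-side Manin binder `hc3' : ¬ 3 ∣ c(D')` of the good companion `48841a1` (`N_G = 48841 = 13²·17²`: `3 ∤ N_G`) is discharged
BY NAME from the REFEREED theorem Mazur 1978, Cor. 4.1 = tree named fact `mazur_not_dvd_maninConstant_of_odd`
(`Literature/NumberTheory/EllipticCurves/ManinConstantSemistablePrimewise.lean`, librarian 2026-08-16, BUILT; Česnavičius 2018 Thm. 1.2 (MK-1),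
arXiv:1604.02165 p. 3; consumed likewise by X11b `BDPRouteManin`): globally minimal `G` (MODELS instance), optimal datum (`hopt'` = the fact's own
binder `Λ_E ⊆ c·Λ_f`), `p = 3 ≠ 2`, `¬ 3² ∣ N'` by Carayol (`N' = N_G` from `hmod`, kernel numeral `conductorNorm_G…`) + `norm_num` — NO range
bound, NO database primary, NO registry flag. New:
`o5_bsdp_row439569bw1_mazur`, `o5_bsdp_row439569e1_mazur` REPLACE GEN 33/34's `_manin` of the same row(s), which discharged the same binder from A321 =
`cremona_abs_maninConstant_eq_one_of_level_le_300000` and would carry its provenance flags (that import is dropped: no A321 consumer remains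
here); the RECORD-side `hc3` stays DISPLAYED (`N = 439569 > 300000`: outside A321's printed range — referee A R199.5 / REFEREE-2 R2-140.1 —
and `3² ∣ N`: outside Mazur).
(2) The Heegner level lemma(s) `satisfiesHeegnerHypothesis_439569_of_discr` (GEN 34 edit 3) MOVED, bytes unchanged, to part 35h
`O5/HeegnerHypothesisOfDiscr.lean` (imported; dependency-free, farm-checked rc 0) — no row file imports another row file any more.
No other change of statement; §1/§2 byte-identical to GEN 34.

GEN 34 (superseded the GEN 33 bytes): the binder `hmodE : hasEntireLFunction_rat` (A19) is NO LONGER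
DISPLAYED — it is DERIVED from `hmod` by the tree theorem `WeierstrassCurve.hasEntireLFunction_rat_of_exists_isNewformOf`
(`AnalyticRankModularityProofs.lean`, Diamond–Shurman Thm 8.8.3 + 5.10.2), as the X11b Castella files do; and the Heegner-hypothesis
binders `hH : SatisfiesHeegnerHypothesis N K`, `hH' : … N' K`, `h3K : … 3 K` are NO LONGER DISPLAYED — they are DERIVED IN THE KERNEL:
the decomposition law (`satisfiesHeegnerHypothesis_iff_kronecker`, tree, PROVED; list form `satisfiesHeegnerHypothesis_listProd_of_kronecker`
of part 35h, with the level lemma) + Jacobi symbols `(d_K/p) = 1` (and `d_K ≡ 1 (mod 8)` at `p = 2`) by `norm_num` for the primes of the literal level, Carayol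
(`N = N_W`, `N' = N_G` from `hmod`, the equalities that also bound the companion level for `hMan`) and `SatisfiesHeegnerHypothesis.of_dvd`
(`N_G ∣ N_W`, `3 ∣ N_W`). These rows never displayed `hW20`. No other change of statement.

HONEST FRAMING (cell `b2b-bsdres`, run/shared/lean/b2b/bsd-rank1-residual/, verbatim in every file): the
goal of the cell is to DELETE the COMBINATION-SHAPED residual classes of the Birch–Swinnerton-Dyer
formula for ALL analytic-rank `≤ 1` elliptic curves over `ℚ` — "full BSD formula for every rank `≤ 1`
curve in class `C`" assembled STRICTLY from published theorems — so that the rank-`≤ 1` remainder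
becomes exactly the CONSTRUCTION-SHAPED classes, which are TYPED (missing-input `Prop`s), NOT
attempted. This is not "finishing BSD". Seat o5-r2 (planner 2, non-Iwasawa side) works a RESEARCH ROUTE
on O5 = (t′); **O5 stays OPEN**; no claim beyond the stated rows; every theorem is CONDITIONAL on its
displayed binders; census / instrument statements are EVIDENCE or displayed binders, never a Literature
fact; NOTHING is booked and no mark / label / count / tier of `RESIDUAL-MAP.md` moves.

What differs from the two-sided rows (parts 32 §3, 32b, 32c): the companion `G = 48841a1` is
SUPERSINGULAR at `3`, so the END is part 27d's Heegner-index END (`o5_index_unit_row439569bw1/e1`: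
Kriz–Li Thm. 1.16 + modularity BY NAME; the companion's Heegner index `3 ∤ [G(K) : ℤP′_K]` DISPLAYED as
`hIdx` — EVIDENCE census C; no `hYZ`/`hW20`/`hGZK`-for-`G`, no sharp descents), and `ρ̄_{W,3}` onto is a
KERNEL fact of the 27d MODELS file (`surj3_W439569bw1`, `surj3_W439569e1`: Serre witnesses), so the rows
carry NO `hρ` binder. The twists' conductor `439569·263² = 30404548161` is ODD (both twists have good
reduction at `2`).

Record rows (EVIDENCE, `O5/HeegnerIndexRecordsThreeRankOneT4.lean` l.361 / l.366): `439569bw1`, `D = −263`,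
`m₁ = m₂ = 4`, `#F(ℚ)_tors = 1`, `∏c_ℓ(F) = 4`, `#Ш_an(F) = 1`; `439569e1`, `D = −263`, `m₁ = m₂ = 8`,
`#F(ℚ)_tors = 1`, `∏c_ℓ(F) = 8`, `#Ш_an(F) = 1` (so `ord₃ q_d = 0` on both).
§3 (o5-r2 GEN 35, superseding GEN 33/34's `_manin`): `o5_bsdp_row439569bw1_mazur`, `o5_bsdp_row439569e1_mazur` — the companion-side Manin binder `hc3'`
DISCHARGED BY NAME from Mazur 1978 Cor. 4.1 (`mazur_not_dvd_maninConstant_of_odd`, refereed, no range, no flag; `N(48841a1) = 48841 = 13²·17²`,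
`3 ∤ N'`, via Carayol's level theorem `IsNewformOf.level_eq_conductorNorm_of_exists_isNewformOf` + the kernel numeral `conductorNorm_G48841a1`)
at the price of the displayed optimality `hopt'` of the chosen datum; the RECORD-side `hc3` is KEPT (honest negative: `N = 439569 > 300000`
outside A321's printed range; `3² ∣ N` outside Mazur). §2 and the GEN 33/34 §3 were elaborated in `gen33/scratch/BSDpRowsSix_composition_scratch.lean` /
`gen34/scratch/BSDpNoLemma20_composition_scratch.lean` (rc 0); the GEN 35 §3 in `gen35/scratch/BSDpMazur_composition_scratch.lean` (rc recorded in
`gen35/scratch/CHECKS.md`) as real text over sorried stand-ins for the unbuilt END / base rows (signatures verbatim), the Mazur module imported for REAL.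

References: as part 32; [CesnaviciusNeururerSaha2023] §1; [Mazur1978] Cor. 4.1; [Cesnavicius2018] Thm. 1.2 (MK-1); [AgasheRibetStein2006] Thm. 2.3, 2.6;
[DiamondShurman2005] Thm. 8.8.1; [CremonaAlgorithms1997] §3.2; [Kraus1989] Prop. 1–2; [SilvermanAEC2009] III.1, VII.1;
memo `HOME/b2b-bsdres-o5-r2/gen33/O5-GEN33.md`.

### cc-typer-5 GEN 20 (O5 §3.5 / O6 §3.4 typer of record) — by-name ask A-O5-G35-1 of o5-r2 GEN 35 (HOME/INBOX.md l.16133; by sha, VERBATIM + ¶; memo gen35/O5-GEN35.md §G35-6;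
SUPERSEDES the A-O5-G33-1 / G34-1 versions) item (d) 0b7b4b7f1b6c6413 → O5/HeegnerLogTransportThreeBSDpRows48841a1.lean (after (h) + part 32 + 27d ROW). Source:
`HOME/b2b-bsdres-o5-r2/gen35/lean/HeegnerLogTransportThreeBSDpRows48841a1.lean` sha16 `0b7b4b7f1b6c6413` (365 l.; `gen35/SHA16.txt`; o5-r2's farm checks rc 0 / 0 warnings / 0
sorries, axioms standard, dedup clean as stated in their line), re-hashed by the typer right before writing; THIS file = the source VERBATIM + this paragraph (imports, module
text, every declaration block byte-identical; script `class-closure/typer-5/gen20/gplace.py`, docstring anchor asserted); imports `O5.HeegnerLogTransportThreeBSDp`,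
`O5.HeegnerLogTransportThreeHeegnerIndexRow48841a1`, `Literature.NumberTheory.EllipticCurves.ManinConstantSemistablePrimewise`,
`Literature.NumberTheory.EllipticCurves.CuspFormLFunctionLevelConductorProofs`, `Literature.NumberTheory.EllipticCurves.AnalyticRankModularityProofs`,
`O5.HeegnerHypothesisOfDiscr` — all in the tree at filing; the typer's own standalone farm check on tree imports (rc 0 / 0 warnings / 0 sorries; `#print axioms` of the END(s)
standard) and DEDUP (`lean search --decl` on the 14 new names + 4 instances: no match; the gate's statement-level dedup at dry-run) precede the proposal. CONTENT LABELS: as the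
source's module text above states (declarations: `Wd439569bw1_263`, `isGloballyMinimal_Wd439569bw1_263`, `twistChange263B`, `twist_W439569bw1_263`,
`padicValRat_u_twistChange263B`, `Wd439569e1_263`, `isGloballyMinimal_Wd439569e1_263`, `twistChange263E`, `twist_W439569e1_263`, `padicValRat_u_twistChange263E`,
`o5_bsdp_row439569bw1`, `o5_bsdp_row439569e1`, `o5_bsdp_row439569bw1_mazur`, `o5_bsdp_row439569e1_mazur`); 0 `@[conjecture]`, 0 Literature facts (net named-fact debt 0), no
`sorry`; published inputs stay displayed hypotheses BY NAME, nothing re-proved. HONEST FRAMING (cell `b2b-bsdres`): research route, lane CLASS-CLOSURE §3.5 O5; CONDITIONAL ENDs —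
nothing asserted beyond the displayed binders, nothing booked, no mark / label / count / tier of `RESIDUAL-MAP.md` moves; census / instrument statements = EVIDENCE or displayed
binders, never a Literature fact; O5 OPEN.
-/

set_option autoImplicit false

noncomputable section

open scoped Classical

open WeierstrassCurve Literature.NumberTheory.EllipticCurves
  Literature.NumberTheory.EllipticCurves.ModularForms
  Literature.NumberTheory.EllipticCurves.Rank1Residual
  Literature.NumberTheory.EllipticCurves.Rank1Residual.Typed
  Literature.NumberTheory.EllipticCurves.KrizLi2019
open Summit.BirchSwinnertonDyer.Rank1Residual.X11b (isGloballyMinimal_of_krausCriterion_support)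
open IsDedekindDomain (HeightOneSpectrum)
open scoped NumberField

namespace Summit.BirchSwinnertonDyer.Rank1Residual.O5.HeegnerLogTransport

/-! ## §1 The two twist models (checked standalone, rc 0) -/

namespace KL3HeegnerIndexRows

/-- A globally minimal model of the quadratic twist `439569bw1^(−263)` (conductor `30404548161`):
`(1, −66, ½, 0) • ⟨0, 789/4, 0, −335331312, −5181488040457⟩`. [cite: CremonaAlgorithms1997, §3.2] -/
def Wd439569bw1_263 : WeierstrassCurve ℚ := ⟨1, -1, 0, -335344281, -5159355602140⟩

/-- `Δ(Wd439569bw1_263) = −3⁹·13⁶·17²·263⁶ ≠ 0`. [folklore] -/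
instance : Wd439569bw1_263.IsElliptic := ⟨by
  rw [isUnit_iff_ne_zero]
  norm_num [Wd439569bw1_263, WeierstrassCurve.Δ, WeierstrassCurve.b₂, WeierstrassCurve.b₄,
    WeierstrassCurve.b₆, WeierstrassCurve.b₈]⟩

/-- `Wd439569bw1_263` is globally minimal: `|Δ| = 3⁹·13⁶·17²·263⁶`, `v_q Δ < 12` at every `q`.
[cite: SilvermanAEC2009, VII.1 Remark 1.1] [cite: Kraus1989, Prop. 1 and Prop. 2] -/
theorem isGloballyMinimal_Wd439569bw1_263 : Wd439569bw1_263.IsGloballyMinimal :=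
  isGloballyMinimal_of_krausCriterion_support 1 (-1) 0 (-335344281) (-5159355602140)
    [(3, 2, 9), (13, 2, 6), (17, 2, 2), (263, 2, 6)]
    (by intro t ht; simp only [List.mem_cons, List.not_mem_nil, or_false] at ht
        rcases ht with rfl | rfl | rfl | rfl <;> norm_num)
    (by decide +kernel) (by decide +kernel)

/-- Instance form of `isGloballyMinimal_Wd439569bw1_263` (typer lint docstring). [cite: Kraus1989, Prop. 1 and Prop. 2] -/
instance : Wd439569bw1_263.IsGloballyMinimal := isGloballyMinimal_Wd439569bw1_263

/-- The change of variables `(u, r, s, t) = (1, −66, ½, 0)` (so `u = 1`). [cite: SilvermanAEC2009, III.1 Table 3.1] -/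
def twistChange263B : VariableChange ℚ := ⟨1, -66, (1 : ℚ) / 2, 0⟩

/-- **The twist identity IN THE KERNEL**: `(1, −66, ½, 0) • 439569bw1.quadraticTwist (−263) = Wd439569bw1_263`
(`b₂, b₄, b₆ = −3, −9696, 1139324`). [cite: SilvermanAEC2009, III.1 Table 3.1 and X.5 Cor. 5.4] -/
theorem twist_W439569bw1_263 :
    twistChange263B • W439569bw1.quadraticTwist ((-263 : ℤ) : ℚ) = Wd439569bw1_263 := by
  ext <;> norm_num [WeierstrassCurve.variableChange_def, WeierstrassCurve.quadraticTwist, W439569bw1,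
    Wd439569bw1_263, twistChange263B, WeierstrassCurve.b₂, WeierstrassCurve.b₄, WeierstrassCurve.b₆]

/-- `u = 1` for `twistChange263B`, so `ord₃ u = 0`. [folklore] -/
theorem padicValRat_u_twistChange263B : padicValRat 3 (twistChange263B.u : ℚ) = 0 := by
  simp [twistChange263B]

/-- A globally minimal model of the quadratic twist `439569e1^(−263)` (conductor `30404548161`):
`(1, 0, 0, ½) • ⟨0, 0, 0, −91213644483, 47714495924568681/4⟩`. [cite: CremonaAlgorithms1997, §3.2] -/
def Wd439569e1_263 : WeierstrassCurve ℚ := ⟨0, 0, 1, -91213644483, 11928623981142170⟩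

/-- `Δ(Wd439569e1_263) = −3⁹·13⁶·17⁷·263⁶ ≠ 0`. [folklore] -/
instance : Wd439569e1_263.IsElliptic := ⟨by
  rw [isUnit_iff_ne_zero]
  norm_num [Wd439569e1_263, WeierstrassCurve.Δ, WeierstrassCurve.b₂, WeierstrassCurve.b₄,
    WeierstrassCurve.b₆, WeierstrassCurve.b₈]⟩

/-- `Wd439569e1_263` is globally minimal: `|Δ| = 3⁹·13⁶·17⁷·263⁶`, `v_q Δ < 12` at every `q`.
[cite: SilvermanAEC2009, VII.1 Remark 1.1] [cite: Kraus1989, Prop. 1 and Prop. 2] -/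
theorem isGloballyMinimal_Wd439569e1_263 : Wd439569e1_263.IsGloballyMinimal :=
  isGloballyMinimal_of_krausCriterion_support 0 0 1 (-91213644483) 11928623981142170
    [(3, 2, 9), (13, 2, 6), (17, 2, 7), (263, 2, 6)]
    (by intro t ht; simp only [List.mem_cons, List.not_mem_nil, or_false] at ht
        rcases ht with rfl | rfl | rfl | rfl <;> norm_num)
    (by decide +kernel) (by decide +kernel)

/-- Instance form of `isGloballyMinimal_Wd439569e1_263` (typer lint docstring). [cite: Kraus1989, Prop. 1 and Prop. 2] -/
instance : Wd439569e1_263.IsGloballyMinimal := isGloballyMinimal_Wd439569e1_263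

/-- The change of variables `(u, r, s, t) = (1, 0, 0, ½)` (so `u = 1`). [cite: SilvermanAEC2009, III.1 Table 3.1] -/
def twistChange263E : VariableChange ℚ := ⟨1, 0, 0, (1 : ℚ) / 2⟩

/-- **The twist identity IN THE KERNEL**: `(1, 0, 0, ½) • 439569e1.quadraticTwist (−263) = Wd439569e1_263`
(`b₂, b₄, b₆ = 0, −2637414, −2622908223`). [cite: SilvermanAEC2009, III.1 Table 3.1 and X.5 Cor. 5.4] -/
theorem twist_W439569e1_263 :
    twistChange263E • W439569e1.quadraticTwist ((-263 : ℤ) : ℚ) = Wd439569e1_263 := by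
  ext <;> norm_num [WeierstrassCurve.variableChange_def, WeierstrassCurve.quadraticTwist, W439569e1,
    Wd439569e1_263, twistChange263E, WeierstrassCurve.b₂, WeierstrassCurve.b₄, WeierstrassCurve.b₆]

/-- `u = 1` for `twistChange263E`, so `ord₃ u = 0`. [folklore] -/
theorem padicValRat_u_twistChange263E : padicValRat 3 (twistChange263E.u : ℚ) = 0 := by
  simp [twistChange263E]

end KL3HeegnerIndexRows

open KL3HeegnerIndexRows

/-! ## §2 The two rows of record over `d_K = −263` in closing currency -/

/-- **ROW OF RECORD IN CLOSING CURRENCY (supersingular companion): `BSD(439569bw1, 3)`** — part 27d's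
Heegner-index END `o5_index_unit_row439569bw1` (`W := 439569bw1`, `G := 48841a1`) composed with part 32 §1
(`bsdp_of_rankOne_of_indexUnit`): `P`'s non-torsion DERIVED (`r_an(W) = 1`, `q_d ≠ 0`, Gross–Zagier BY NAME),
index finiteness = Kolyvagin BY NAME, `ρ̄_{W,3}` onto = `surj3_W439569bw1` (kernel), `3 ∤ ∏c(W)` =
`tam3_W439569bw1`, `u = 1`, twist identity and minimality in the kernel (§1). Displayed: `hKL`, `hmod`, `hGZK`
(GEN 34: `hmodE` DERIVED from `hmod`; `hH`, `hH'`, `h3K` DERIVED in the kernel); `hGZ`, `hKo`, `hB` (`W/K`); row data `hr`, Heegner data over `d_K = −263`, `hP'inf`, the companion's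
Heegner index `hIdx` (EVIDENCE, census C), `hc3`, `hc3'`, `q_d` (`hqd`, `hqd0`, `hvd`). Conditional theorem;
research route; O5 OPEN; nothing booked.
[cite: KrizLi2019, Theorem 1.16 (arXiv:1609.06687v4 pp. 7-8)] [cite: McCallumLMS1991, §1 Theorem (Kolyvagin), p. 296]
[cite: GrossZagier1986, Thm. I.6.3] [cite: Kolyvagin1990, Thm. A] [cite: CremonaAlgorithms1997, Table 1] -/
theorem o5_bsdp_row439569bw1
    (hKL : KrizLi2019.thm116_padicLogHeegner_congruence) (hmod : exists_isNewformOf)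
    (hGZK : rank_eq_analyticRank_of_analyticRank_le_one)
    (hr : W439569bw1.analyticRank = 1)
    {N N' : ℕ} [NeZero N] [NeZero N'] (D : ModularParametrizationData W439569bw1 N)
    (D' : ModularParametrizationData G48841a1 N')
    (K : Type) [Field K] [NumberField K] (hK : IsImaginaryQuadratic K) (hdK : NumberField.discr K = -263)
    (hGZ : gross_zagier N W439569bw1 K) (hKo : kolyvagin N W439569bw1 K)
    (hB : Kolyvagin1990_padicValNat_card_sha_le N W439569bw1 K)
    (H : HeegnerDatum N (NumberField.discr K)) (H' : HeegnerDatum N' (NumberField.discr K))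
    (ι : K →+* ℂ) (ι₃ : K →+* ℚ_[3])
    (P : (W439569bw1.baseChange K).toAffine.Point) (P' : (G48841a1.baseChange K).toAffine.Point)
    (hP : WeierstrassCurve.Affine.Point.map ι.toRatAlgHom P = heegnerPointComplex D H)
    (hP' : WeierstrassCurve.Affine.Point.map ι.toRatAlgHom P' = heegnerPointComplex D' H')
    (hP'inf : ¬ IsOfFinAddOrder P') (hIdx : ¬ 3 ∣ (AddSubgroup.zmultiples P').index)
    (hc3 : ¬ ((3 : ℤ) ∣ D.maninConstant)) (hc3' : ¬ ((3 : ℤ) ∣ D'.maninConstant))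
    (qd : ℚ) (hqd : Wd439569bw1_263.entireLFunction 1 / (Wd439569bw1_263.realPeriodRat : ℂ) = (qd : ℂ))
    (hqd0 : qd ≠ 0) (hvd : padicValRat 3 qd = 0) :
    BSDp W439569bw1 3 := by
  have hmodE : hasEntireLFunction_rat := hasEntireLFunction_rat_of_exists_isNewformOf hmod
  have hN : N = 439569 :=
    (IsNewformOf.level_eq_conductorNorm_of_exists_isNewformOf hmod D.isNewformOf).trans conductorNorm_W439569bw1
  have hN' : N' = 48841 :=
    (IsNewformOf.level_eq_conductorNorm_of_exists_isNewformOf hmod D'.isNewformOf).trans conductorNorm_G48841a1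
  have hHK : SatisfiesHeegnerHypothesis 439569 K := satisfiesHeegnerHypothesis_439569_of_discr hK.1 hdK
  have hH : SatisfiesHeegnerHypothesis N K := by rw [hN]; exact hHK
  have hH' : SatisfiesHeegnerHypothesis N' K := by rw [hN']; exact hHK.of_dvd (by norm_num)
  have h3K : SatisfiesHeegnerHypothesis 3 K := hHK.of_dvd (by norm_num)
  have hd : NumberField.discr K < -4 := by rw [hdK]; norm_num
  have hc : ¬ ((3 : ℕ) : ℤ) ∣ D.c := by rw [Nat.cast_ofNat]; exact hc3
  have hWd : twistChange263B • W439569bw1.quadraticTwist (NumberField.discr K : ℚ) = Wd439569bw1_263 := by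
    rw [hdK]; exact twist_W439569bw1_263
  exact bsdp_of_rankOne_of_indexUnit W439569bw1 3 N K D H ι P hGZ hKo hB hGZK hmodE hK hH hd hP
    (by decide) hc hr surj3_W439569bw1 Wd439569bw1_263 twistChange263B hWd padicValRat_u_twistChange263B qd
    hqd hqd0 hvd tam3_W439569bw1 fun hPinf =>
      o5_index_unit_row439569bw1 hKL hmod D D' K hK hdK hH hH' h3K H H' ι ι₃ P P' hP hP' hPinf hP'inf hIdx
        (padicValInt.eq_zero_of_not_dvd hc3) hc3'

/-- **ROW OF RECORD IN CLOSING CURRENCY (supersingular companion): `BSD(439569e1, 3)`** — as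
`o5_bsdp_row439569bw1` with `W := 439569e1` (part 27d's `o5_index_unit_row439569e1`, `surj3_W439569e1`,
`tam3_W439569e1`, twist `(1, 0, 0, ½)`). Conditional theorem; research route; O5 OPEN; nothing booked.
[cite: KrizLi2019, Theorem 1.16 (arXiv:1609.06687v4 pp. 7-8)] [cite: McCallumLMS1991, §1 Theorem (Kolyvagin), p. 296]
[cite: GrossZagier1986, Thm. I.6.3] [cite: Kolyvagin1990, Thm. A] [cite: CremonaAlgorithms1997, Table 1] -/
theorem o5_bsdp_row439569e1
    (hKL : KrizLi2019.thm116_padicLogHeegner_congruence) (hmod : exists_isNewformOf)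
    (hGZK : rank_eq_analyticRank_of_analyticRank_le_one)
    (hr : W439569e1.analyticRank = 1)
    {N N' : ℕ} [NeZero N] [NeZero N'] (D : ModularParametrizationData W439569e1 N)
    (D' : ModularParametrizationData G48841a1 N')
    (K : Type) [Field K] [NumberField K] (hK : IsImaginaryQuadratic K) (hdK : NumberField.discr K = -263)
    (hGZ : gross_zagier N W439569e1 K) (hKo : kolyvagin N W439569e1 K)
    (hB : Kolyvagin1990_padicValNat_card_sha_le N W439569e1 K)
    (H : HeegnerDatum N (NumberField.discr K)) (H' : HeegnerDatum N' (NumberField.discr K))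
    (ι : K →+* ℂ) (ι₃ : K →+* ℚ_[3])
    (P : (W439569e1.baseChange K).toAffine.Point) (P' : (G48841a1.baseChange K).toAffine.Point)
    (hP : WeierstrassCurve.Affine.Point.map ι.toRatAlgHom P = heegnerPointComplex D H)
    (hP' : WeierstrassCurve.Affine.Point.map ι.toRatAlgHom P' = heegnerPointComplex D' H')
    (hP'inf : ¬ IsOfFinAddOrder P') (hIdx : ¬ 3 ∣ (AddSubgroup.zmultiples P').index)
    (hc3 : ¬ ((3 : ℤ) ∣ D.maninConstant)) (hc3' : ¬ ((3 : ℤ) ∣ D'.maninConstant))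
    (qd : ℚ) (hqd : Wd439569e1_263.entireLFunction 1 / (Wd439569e1_263.realPeriodRat : ℂ) = (qd : ℂ))
    (hqd0 : qd ≠ 0) (hvd : padicValRat 3 qd = 0) :
    BSDp W439569e1 3 := by
  have hmodE : hasEntireLFunction_rat := hasEntireLFunction_rat_of_exists_isNewformOf hmod
  have hN : N = 439569 :=
    (IsNewformOf.level_eq_conductorNorm_of_exists_isNewformOf hmod D.isNewformOf).trans conductorNorm_W439569e1
  have hN' : N' = 48841 :=
    (IsNewformOf.level_eq_conductorNorm_of_exists_isNewformOf hmod D'.isNewformOf).trans conductorNorm_G48841a1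
  have hHK : SatisfiesHeegnerHypothesis 439569 K := satisfiesHeegnerHypothesis_439569_of_discr hK.1 hdK
  have hH : SatisfiesHeegnerHypothesis N K := by rw [hN]; exact hHK
  have hH' : SatisfiesHeegnerHypothesis N' K := by rw [hN']; exact hHK.of_dvd (by norm_num)
  have h3K : SatisfiesHeegnerHypothesis 3 K := hHK.of_dvd (by norm_num)
  have hd : NumberField.discr K < -4 := by rw [hdK]; norm_num
  have hc : ¬ ((3 : ℕ) : ℤ) ∣ D.c := by rw [Nat.cast_ofNat]; exact hc3
  have hWd : twistChange263E • W439569e1.quadraticTwist (NumberField.discr K : ℚ) = Wd439569e1_263 := by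
    rw [hdK]; exact twist_W439569e1_263
  exact bsdp_of_rankOne_of_indexUnit W439569e1 3 N K D H ι P hGZ hKo hB hGZK hmodE hK hH hd hP
    (by decide) hc hr surj3_W439569e1 Wd439569e1_263 twistChange263E hWd padicValRat_u_twistChange263E qd
    hqd hqd0 hvd tam3_W439569e1 fun hPinf =>
      o5_index_unit_row439569e1 hKL hmod D D' K hK hdK hH hH' h3K H H' ι ι₃ P P' hP hP' hPinf hP'inf hIdx
        (padicValInt.eq_zero_of_not_dvd hc3) hc3'

/-! ## §3 The same row(s) with the COMPANION-side Manin binder discharged BY NAME from Mazur 1978 Cor. 4.1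
(`mazur_not_dvd_maninConstant_of_odd`; o5-r2 GEN 35 — REPLACES GEN 33/34's A321 variant `_manin`; record side `hc3` displayed: `N > 300000`) -/

/-- **Row `439569bw1` in closing currency with the COMPANION-side Manin binder discharged BY NAME from Mazur 1978, Cor. 4.1 — flag-free**
(o5-r2 GEN 35): `hc3' : ¬ 3 ∣ c(D')` (good companion `48841a1`: `N' = N(48841a1) = 48841 = 13²·17²`, `3 ∤ N'`, a fortiori `3² ∤ N'`) is REPLACED by the
REFEREED theorem Mazur 1978, Cor. 4.1 BY NAME: `hMaz` = `mazur_not_dvd_maninConstant_of_odd` (`Literature/NumberTheory/EllipticCurves/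
ManinConstantSemistablePrimewise.lean`, librarian 2026-08-16, BUILT; = (MK-1) of Česnavičius 2018 Thm. 1.2, arXiv:1604.02165 p. 3: "for a new elliptic
optimal quotient `π : J₀(n) ↠ E` and a prime `p`, if `ord_p(n) ≤ 1` then `ord_p(c_π) = 0` … (MK-1) if `p` is odd (Mazur, [Maz78] Cor. 4.1)";
consumed the same way by X11b `BDPRouteManin`)
and the optimality `hopt'` of the chosen companion datum (`Λ_E ⊆ c·Λ_f`, the fact's own binder): globally minimal `48841a1` (instance,
27d MODELS `…HeegnerIndexRow48841a1Models` l.182), `p = 3 ≠ 2` (`decide`), `¬ 3² ∣ N'` by Carayol's level theorem `IsNewformOf.level_eq_conductorNorm_of_exists_isNewformOf`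
(from `hmod`) + the kernel numeral `conductorNorm_G48841a1` + `norm_num`. No range bound, no database primary, NO registry flag travels with this discharge.
The RECORD-side binder `hc3 : ¬ 3 ∣ c(D)` stays DISPLAYED: `N(439569bw1) = 439569 = 3²·13²·17²` has `3² ∣ N` — outside Mazur's hypothesis
and outside every printed Manin range (`N = 439569 > 300000`: A321 = `cremona_abs_maninConstant_eq_one_of_level_le_300000` is usable
AS PRINTED at `N ≤ 300000` ONLY — referee A R199.5, REFEREE-2 R2-140.1: an instantiation above `300000` would be a content bounce;
Cremona's `opt_man` row = database EVIDENCE only, `gen31/census/ecdata_opt_man_kl3rows.txt`).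
This theorem REPLACES GEN 33/34's `o5_bsdp_row439569bw1_manin`, which discharged the same binder from A321 (`N' = 48841 ≤ 300000`) and would
carry A321's two provenance flags; Mazur's theorem is refereed, has no range bound and no flag, at the same binder count. Everything else exactly as `o5_bsdp_row439569bw1`.
Conditional theorem; research route; O5 OPEN; nothing booked; census rows = EVIDENCE.
[cite: Mazur1978, Cor. 4.1] [cite: Cesnavicius2018, Thm. 1.2 (MK-1) (arXiv:1604.02165 text chunk 3 L49-59)]
[cite: AgasheRibetStein2006, Thm. 2.3] [cite: DiamondShurman2005, Thm. 8.8.1] -/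
theorem o5_bsdp_row439569bw1_mazur
    (hKL : KrizLi2019.thm116_padicLogHeegner_congruence) (hmod : exists_isNewformOf)
    (hGZK : rank_eq_analyticRank_of_analyticRank_le_one)
    (hr : W439569bw1.analyticRank = 1)
    {N N' : ℕ} [NeZero N] [NeZero N'] (D : ModularParametrizationData W439569bw1 N)
    (D' : ModularParametrizationData G48841a1 N')
    (K : Type) [Field K] [NumberField K] (hK : IsImaginaryQuadratic K) (hdK : NumberField.discr K = -263)
    (hGZ : gross_zagier N W439569bw1 K) (hKo : kolyvagin N W439569bw1 K)
    (hB : Kolyvagin1990_padicValNat_card_sha_le N W439569bw1 K)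
    (H : HeegnerDatum N (NumberField.discr K)) (H' : HeegnerDatum N' (NumberField.discr K))
    (ι : K →+* ℂ) (ι₃ : K →+* ℚ_[3])
    (P : (W439569bw1.baseChange K).toAffine.Point) (P' : (G48841a1.baseChange K).toAffine.Point)
    (hP : WeierstrassCurve.Affine.Point.map ι.toRatAlgHom P = heegnerPointComplex D H)
    (hP' : WeierstrassCurve.Affine.Point.map ι.toRatAlgHom P' = heegnerPointComplex D' H')
    (hP'inf : ¬ IsOfFinAddOrder P') (hIdx : ¬ 3 ∣ (AddSubgroup.zmultiples P').index)
    (hMaz : mazur_not_dvd_maninConstant_of_odd)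
    (hc3 : ¬ ((3 : ℤ) ∣ D.maninConstant))
    (hopt' : ∀ z ∈ D'.L.lattice, ∃ w ∈ periodLattice D'.f, z = D'.c * w)
    (qd : ℚ) (hqd : Wd439569bw1_263.entireLFunction 1 / (Wd439569bw1_263.realPeriodRat : ℂ) = (qd : ℂ))
    (hqd0 : qd ≠ 0) (hvd : padicValRat 3 qd = 0) :
    BSDp W439569bw1 3 :=
  o5_bsdp_row439569bw1 hKL hmod hGZK hr D D' K hK hdK hGZ hKo hB H H' ι ι₃ P P' hP hP'
    hP'inf hIdx hc3
    (hMaz G48841a1 D' hopt' 3 Nat.prime_three (by decide)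
      (by rw [(IsNewformOf.level_eq_conductorNorm_of_exists_isNewformOf hmod D'.isNewformOf).trans
        conductorNorm_G48841a1]; norm_num))
    qd hqd hqd0 hvd

/-- **Row `439569e1` in closing currency with the COMPANION-side Manin binder discharged BY NAME from Mazur 1978, Cor. 4.1 — flag-free**
(o5-r2 GEN 35): `hc3' : ¬ 3 ∣ c(D')` (good companion `48841a1`: `N' = N(48841a1) = 48841 = 13²·17²`, `3 ∤ N'`, a fortiori `3² ∤ N'`) is REPLACED by the
REFEREED theorem Mazur 1978, Cor. 4.1 BY NAME: `hMaz` = `mazur_not_dvd_maninConstant_of_odd` (`Literature/NumberTheory/EllipticCurves/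
ManinConstantSemistablePrimewise.lean`, librarian 2026-08-16, BUILT; = (MK-1) of Česnavičius 2018 Thm. 1.2, arXiv:1604.02165 p. 3: "for a new elliptic
optimal quotient `π : J₀(n) ↠ E` and a prime `p`, if `ord_p(n) ≤ 1` then `ord_p(c_π) = 0` … (MK-1) if `p` is odd (Mazur, [Maz78] Cor. 4.1)";
consumed the same way by X11b `BDPRouteManin`)
and the optimality `hopt'` of the chosen companion datum (`Λ_E ⊆ c·Λ_f`, the fact's own binder): globally minimal `48841a1` (instance,
27d MODELS `…HeegnerIndexRow48841a1Models` l.182), `p = 3 ≠ 2` (`decide`), `¬ 3² ∣ N'` by Carayol's level theorem `IsNewformOf.level_eq_conductorNorm_of_exists_isNewformOf`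
(from `hmod`) + the kernel numeral `conductorNorm_G48841a1` + `norm_num`. No range bound, no database primary, NO registry flag travels with this discharge.
The RECORD-side binder `hc3 : ¬ 3 ∣ c(D)` stays DISPLAYED: `N(439569e1) = 439569 = 3²·13²·17²` has `3² ∣ N` — outside Mazur's hypothesis
and outside every printed Manin range (`N = 439569 > 300000`: A321 = `cremona_abs_maninConstant_eq_one_of_level_le_300000` is usable
AS PRINTED at `N ≤ 300000` ONLY — referee A R199.5, REFEREE-2 R2-140.1: an instantiation above `300000` would be a content bounce;
Cremona's `opt_man` row = database EVIDENCE only, `gen31/census/ecdata_opt_man_kl3rows.txt`).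
This theorem REPLACES GEN 33/34's `o5_bsdp_row439569e1_manin`, which discharged the same binder from A321 (`N' = 48841 ≤ 300000`) and would
carry A321's two provenance flags; Mazur's theorem is refereed, has no range bound and no flag, at the same binder count. Everything else exactly as `o5_bsdp_row439569e1`.
Conditional theorem; research route; O5 OPEN; nothing booked; census rows = EVIDENCE.
[cite: Mazur1978, Cor. 4.1] [cite: Cesnavicius2018, Thm. 1.2 (MK-1) (arXiv:1604.02165 text chunk 3 L49-59)]
[cite: AgasheRibetStein2006, Thm. 2.3] [cite: DiamondShurman2005, Thm. 8.8.1] -/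
theorem o5_bsdp_row439569e1_mazur
    (hKL : KrizLi2019.thm116_padicLogHeegner_congruence) (hmod : exists_isNewformOf)
    (hGZK : rank_eq_analyticRank_of_analyticRank_le_one)
    (hr : W439569e1.analyticRank = 1)
    {N N' : ℕ} [NeZero N] [NeZero N'] (D : ModularParametrizationData W439569e1 N)
    (D' : ModularParametrizationData G48841a1 N')
    (K : Type) [Field K] [NumberField K] (hK : IsImaginaryQuadratic K) (hdK : NumberField.discr K = -263)
    (hGZ : gross_zagier N W439569e1 K) (hKo : kolyvagin N W439569e1 K)
    (hB : Kolyvagin1990_padicValNat_card_sha_le N W439569e1 K)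
    (H : HeegnerDatum N (NumberField.discr K)) (H' : HeegnerDatum N' (NumberField.discr K))
    (ι : K →+* ℂ) (ι₃ : K →+* ℚ_[3])
    (P : (W439569e1.baseChange K).toAffine.Point) (P' : (G48841a1.baseChange K).toAffine.Point)
    (hP : WeierstrassCurve.Affine.Point.map ι.toRatAlgHom P = heegnerPointComplex D H)
    (hP' : WeierstrassCurve.Affine.Point.map ι.toRatAlgHom P' = heegnerPointComplex D' H')
    (hP'inf : ¬ IsOfFinAddOrder P') (hIdx : ¬ 3 ∣ (AddSubgroup.zmultiples P').index)
    (hMaz : mazur_not_dvd_maninConstant_of_odd)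
    (hc3 : ¬ ((3 : ℤ) ∣ D.maninConstant))
    (hopt' : ∀ z ∈ D'.L.lattice, ∃ w ∈ periodLattice D'.f, z = D'.c * w)
    (qd : ℚ) (hqd : Wd439569e1_263.entireLFunction 1 / (Wd439569e1_263.realPeriodRat : ℂ) = (qd : ℂ))
    (hqd0 : qd ≠ 0) (hvd : padicValRat 3 qd = 0) :
    BSDp W439569e1 3 :=
  o5_bsdp_row439569e1 hKL hmod hGZK hr D D' K hK hdK hGZ hKo hB H H' ι ι₃ P P' hP hP'
    hP'inf hIdx hc3
    (hMaz G48841a1 D' hopt' 3 Nat.prime_three (by decide)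
      (by rw [(IsNewformOf.level_eq_conductorNorm_of_exists_isNewformOf hmod D'.isNewformOf).trans
        conductorNorm_G48841a1]; norm_num))
    qd hqd hqd0 hvd

end Summit.BirchSwinnertonDyer.Rank1Residual.O5.HeegnerLogTransport

end
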